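import Summits.ValiantsHypothesis.ValiantsHypothesis.Theorems.LacunarySymmetroidMatrixDescartesCensusDoorA34RootRank
import Summits.ValiantsHypothesis.ValiantsHypothesis.Theorems.KPlusLogSqLawWindowDescartesSmoothing

/-!
# `MatrixDescartes` census — DOOR A at `(3,4)`: the TYPE POLYNOMIAL `tr adj P(x)` lives on the ten pair sums —
# at most NINE changes of conic type along the roots of a hypothetical nineteen

HONEST FRAMING.  Object-search cell `pub-symmetroid`, route `LacunarySymmetroid`; beside the OPEN typed statement
`Theses.LacunarySymmetroid.DoorA34` (stmt-ValiantsHypothesis-19980, `= DoorA34 = PosRootLawAt 3 4 18`), asserted nowhere.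
Continuation of `…CensusDoorA34RootRank` (rank two at every root of a nineteen; for symmetric letters `ε(r) = sign tr adj P(r)
≠ 0` is the TYPE of the degenerate conic `P(r)`: `+` semidefinite / conjugate line pair, `−` indefinite / real line pair).
Here, for ALL supports and with NO definiteness hypothesis:

* `adjugate_pencil_diag_eq_det` — a principal `2 × 2` minor of the `3 × 3` pencil `Σ_l X^{d l} S_l` is the determinant of the
  `2 × 2` pencil of the corresponding principal submatrices; hence `support_trace_adjugate_pencil_subset`: the TYPE POLYNOMIAL
  `tr adj (Σ_l X^{d l} S_l)` (`= E₂`, the sum of the three principal `2 × 2` minors) is supported on the PAIR sums `d l + d l'`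
  — at most `10` monomials (`card_pairSums_four_le`, `card_support_trace_adjugate_pencil_le`), so at most `9` sign variations.
* `eval_trace_adjugate_pencil` — its value at `x` is `tr adj P(x)`.
* **`sgnChanges_type_le_nine_of_nineteen`** — along ANY increasing list of positive det-roots of a real symmetric `(3,4)` pencil
  with `19` distinct positive det-roots, the type `tr adj P(r)` (non-zero at each root, `…RootRank`) changes sign AT MOST `9`
  TIMES: the nineteen degenerate conics come in at most ten blocks of constant type.  In inertia language (eigenvalue count
  `n₋(x)` stepping `±1` at each simple root; type `+` = step `0↔1` or `2↔3`, type `−` = step `1↔2`): at most `9` of the `18`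
  consecutive step pairs are monotone continuations (`0→1→2`, `1→2→3` or back), at least `9` are turn-arounds.
  This is the cell's first SIGN-LEVEL necessary condition on a `(3,4)` nineteen that is valid for the all-indefinite word.

NOTHING here bounds `ζ_sym(3,4)`; `DoorA34` stays OPEN; nothing bears on `MatrixDescartes` (stmt-ValiantsHypothesis-18050) or
on `VP ≠ VNP`.  [folklore] Descartes' rule along points (tree `sgnChanges_eval_le_signVariations`) + support bookkeeping.
-/

-- `Summit.ValiantsHypothesis.ValiantsHypothesis.…` repeats a component by the D-0017 layout
-- (single-conjunct summit), which the `dupNamespace` linter flags; the name is mandated.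
set_option linter.dupNamespace false

namespace Summit.ValiantsHypothesis.ValiantsHypothesis.Theorems.LacunarySymmetroidMatrixDescartes.Census

open Polynomial Finset
open scoped BigOperators Polynomial Matrix
open Summit.ValiantsHypothesis.ValiantsHypothesis.Theorems.KPlusLogSqLaw.WindowDescartes (sgnChanges
  sgnChanges_eval_le_signVariations)

/-! ## The type polynomial is supported on the pair sums -/

/-- Submatrices commute with the pencil construction. [folklore] -/
theorem submatrix_pencil {K m k : ℕ} (d : Fin K → ℕ) (S : Fin K → Matrix (Fin m) (Fin m) ℝ) (e : Fin k → Fin m) :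
    (∑ l, ((X : ℝ[X]) ^ d l) • (S l).map C).submatrix e e
      = ∑ l, ((X : ℝ[X]) ^ d l) • ((S l).submatrix e e).map C := by
  refine Matrix.ext fun i j => ?_
  simp [Matrix.submatrix_apply, Matrix.sum_apply, Matrix.smul_apply]

/-- **A principal `2 × 2` minor of the `3 × 3` pencil is a `2 × 2` pencil determinant**: the diagonal adjugate entry
`(adj Σ_l X^{d l} S_l) i i` is `det (Σ_l X^{d l} S_l^{(i)})`, `S_l^{(i)}` the principal submatrix of `S_l` avoiding `i`. [folklore] -/
theorem adjugate_pencil_diag_eq_det {K : ℕ} (d : Fin K → ℕ) (S : Fin K → Matrix (Fin 3) (Fin 3) ℝ) (i : Fin 3) :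
    (∑ l, ((X : ℝ[X]) ^ d l) • (S l).map C).adjugate i i
      = (∑ l, ((X : ℝ[X]) ^ d l) • ((S l).submatrix (Fin.succAbove i) (Fin.succAbove i)).map C).det := by
  rw [← submatrix_pencil, Matrix.det_fin_two, Matrix.adjugate_fin_three]
  fin_cases i <;> simp [Matrix.submatrix_apply, Fin.succAbove]

/-- The pair-sum table of four exponents has at most `10` distinct values. [folklore] -/
theorem card_pairSums_four_le (d : Fin 4 → ℕ) :
    ((Finset.univ : Finset (Fin 2 → Fin 4)).image (fun f => ∑ i, d (f i))).card ≤ 10 := by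
  classical
  have hsub : (Finset.univ : Finset (Fin 2 → Fin 4)).image (fun f => ∑ i, d (f i)) ⊆
      ((Finset.univ : Finset (Fin 4 × Fin 4)).filter (fun p => p.1 ≤ p.2)).image (fun p => d p.1 + d p.2) := by
    intro x hx
    obtain ⟨g, _, rfl⟩ := Finset.mem_image.mp hx
    rw [Fin.sum_univ_two]
    rcases le_total (g 0) (g 1) with h | h
    · exact Finset.mem_image.mpr ⟨(g 0, g 1), Finset.mem_filter.mpr ⟨Finset.mem_univ _, h⟩, rfl⟩
    · exact Finset.mem_image.mpr ⟨(g 1, g 0), Finset.mem_filter.mpr ⟨Finset.mem_univ _, h⟩, by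
        simp only; ring⟩
  have hcard : ((Finset.univ : Finset (Fin 4 × Fin 4)).filter (fun p => p.1 ≤ p.2)).card = 10 := by decide
  exact (Finset.card_le_card hsub).trans (Finset.card_image_le.trans hcard.le)

/-- **The type polynomial lives on the pair sums**: `supp tr adj (Σ_l X^{d l} S_l) ⊆ {d l + d l'}` (any real `3 × 3`
letters). [folklore] -/
theorem support_trace_adjugate_pencil_subset (d : Fin 4 → ℕ) (S : Fin 4 → Matrix (Fin 3) (Fin 3) ℝ) :
    (∑ l, ((X : ℝ[X]) ^ d l) • (S l).map C).adjugate.trace.support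
      ⊆ (Finset.univ : Finset (Fin 2 → Fin 4)).image (fun f => ∑ i, d (f i)) := by
  rw [Matrix.trace_fin_three, adjugate_pencil_diag_eq_det, adjugate_pencil_diag_eq_det, adjugate_pencil_diag_eq_det]
  refine (Polynomial.support_add.trans (Finset.union_subset (Polynomial.support_add.trans (Finset.union_subset ?_ ?_)) ?_))
  · exact support_det_pencil_subset_sumset d _
  · exact support_det_pencil_subset_sumset d _
  · exact support_det_pencil_subset_sumset d _

/-- Hence the type polynomial has at most `10` monomials … [folklore] -/
theorem card_support_trace_adjugate_pencil_le (d : Fin 4 → ℕ) (S : Fin 4 → Matrix (Fin 3) (Fin 3) ℝ) :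
    (∑ l, ((X : ℝ[X]) ^ d l) • (S l).map C).adjugate.trace.support.card ≤ 10 :=
  (Finset.card_le_card (support_trace_adjugate_pencil_subset d S)).trans (card_pairSums_four_le d)

/-- … and at most `9` sign variations. [folklore] -/
theorem signVariations_trace_adjugate_pencil_le (d : Fin 4 → ℕ) (S : Fin 4 → Matrix (Fin 3) (Fin 3) ℝ) :
    (∑ l, ((X : ℝ[X]) ^ d l) • (S l).map C).adjugate.trace.signVariations ≤ 9 := by
  set g := (∑ l, ((X : ℝ[X]) ^ d l) • (S l).map C).adjugate.trace with hg
  by_cases h0 : g = 0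
  · rw [h0]; simp
  · have h1 := Literature.Computability.AlgebraicComplexity.signVariations_lt_card_support h0
    have h2 := card_support_trace_adjugate_pencil_le d S
    rw [← hg] at h2
    omega

/-- **Evaluation**: the type polynomial at `x` is `tr adj P(x)`. [folklore] -/
theorem eval_trace_adjugate_pencil {K : ℕ} (d : Fin K → ℕ) (S : Fin K → Matrix (Fin 3) (Fin 3) ℝ) (x : ℝ) :
    ((∑ l, ((X : ℝ[X]) ^ d l) • (S l).map C).adjugate.trace).eval x = (∑ l, x ^ d l • S l).adjugate.trace := by
  set M := (∑ l, ((X : ℝ[X]) ^ d l) • (S l).map C) with hM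
  have h1 : (M.adjugate.trace).eval x = (M.adjugate.map (eval x)).trace := by
    simp only [Matrix.trace, Matrix.diag, Matrix.map_apply, Polynomial.eval_finsetSum]
  have h2 : M.adjugate.map (eval x) = (M.map (eval x)).adjugate := by
    have := RingHom.map_adjugate (evalRingHom x) M
    simpa [RingHom.mapMatrix_apply, Polynomial.coe_evalRingHom] using this
  rw [h1, h2, hM, map_eval_pencil]

/-! ## At most nine changes of type along the roots of a nineteen -/

/-- **AT MOST NINE CHANGES OF CONIC TYPE ALONG THE ROOTS OF A `(3,4)` NINETEEN.**  Let `P = Σ_l X^{d l} S_l` have real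
symmetric `3 × 3` letters (any support) and `19` distinct positive det-roots, and let `xs` be any strictly increasing list
of positive det-roots.  Then the type `tr adj P(r)` — non-zero at every root (`trace_adjugate_pencil_ne_zero_of_nineteen`),
`> 0` for a semidefinite (conjugate-line-pair) conic and `< 0` for an indefinite (real-line-pair) conic
(`root_type_dichotomy_of_nineteen`) — changes sign at most `9` times along `xs`: the `19` degenerate conics of a nineteen
come in at most ten blocks of constant type (equivalently, the inertia walk has at most `9` monotone continuations). [folklore] -/
theorem sgnChanges_type_le_nine_of_nineteen (d : Fin 4 → ℕ) (S : Fin 4 → Matrix (Fin 3) (Fin 3) ℝ)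
    (hS : ∀ l, (S l).IsSymm)
    (h19 : 19 ≤ ((Matrix.det (∑ l, ((X : ℝ[X]) ^ d l) • (S l).map C)).roots.toFinset.filter (fun t => 0 < t)).card)
    (xs : List ℝ) (hsort : xs.Pairwise (· < ·))
    (hroots : ∀ x ∈ xs, 0 < x ∧ (Matrix.det (∑ l, ((X : ℝ[X]) ^ d l) • (S l).map C)).IsRoot x) :
    sgnChanges (xs.map fun t => (∑ l, t ^ d l • S l).adjugate.trace) ≤ 9 := by
  set g := (∑ l, ((X : ℝ[X]) ^ d l) • (S l).map C).adjugate.trace with hg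
  have hmap : (xs.map fun t => (∑ l, t ^ d l • S l).adjugate.trace) = xs.map fun t => g.eval t := by
    refine List.map_congr_left fun t _ => ?_
    rw [hg, eval_trace_adjugate_pencil]
  rw [hmap]
  have hne : ∀ y ∈ xs, g.eval y ≠ 0 := by
    intro y hy
    rw [hg, eval_trace_adjugate_pencil]
    exact trace_adjugate_pencil_ne_zero_of_nineteen d S hS h19 (hroots y hy).1 (hroots y hy).2
  exact (sgnChanges_eval_le_signVariations g xs hsort (fun y hy => (hroots y hy).1) hne).trans
    (signVariations_trace_adjugate_pencil_le d S)

/-- **The same, packaged with non-vanishing**: along any increasing list of positive det-roots of a symmetric `(3,4)`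
nineteen, every type value is non-zero and the list of types has at most `9` sign changes. [folklore] -/
theorem type_sequence_of_nineteen (d : Fin 4 → ℕ) (S : Fin 4 → Matrix (Fin 3) (Fin 3) ℝ)
    (hS : ∀ l, (S l).IsSymm)
    (h19 : 19 ≤ ((Matrix.det (∑ l, ((X : ℝ[X]) ^ d l) • (S l).map C)).roots.toFinset.filter (fun t => 0 < t)).card)
    (xs : List ℝ) (hsort : xs.Pairwise (· < ·))
    (hroots : ∀ x ∈ xs, 0 < x ∧ (Matrix.det (∑ l, ((X : ℝ[X]) ^ d l) • (S l).map C)).IsRoot x) :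
    (∀ x ∈ xs, (∑ l, x ^ d l • S l).adjugate.trace ≠ 0) ∧
      sgnChanges (xs.map fun t => (∑ l, t ^ d l • S l).adjugate.trace) ≤ 9 :=
  ⟨fun x hx => trace_adjugate_pencil_ne_zero_of_nineteen d S hS h19 (hroots x hx).1 (hroots x hx).2,
    sgnChanges_type_le_nine_of_nineteen d S hS h19 xs hsort hroots⟩

end Summit.ValiantsHypothesis.ValiantsHypothesis.Theorems.LacunarySymmetroidMatrixDescartes.Census
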